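import Summits.PneNP.PneNP.Theses.ChoicelessCapture
import Literature.ModelTheory.FiniteModelTheory.CPTCardInvariance
import Literature.ModelTheory.FiniteModelTheory.CPTProofs

/-!
# `ChoicelessCapturesP` (stmt-PneNP-18190, route PneNP/ChoicelessCapture, crux #2) — negative-side lemmas

Crux-attack-at-birth output for
`Summit.PneNP.PneNP.Theses.ChoicelessCapture.ChoicelessCapturesP :
  ∀ C, IsIsoClosed C → IsPTIMEClass C → CPTCardDefinable C`
(the Blass–Gurevich–Shelah question "does CPT+Card capture P on finite graphs?", interface-free).
The crux is NOT refuted (it is the open problem itself); this file records, as theorems, that BOTH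
hypotheses are load-bearing and that the hypotheses are jointly satisfiable by a non-trivial class:

* `eq_setOf_halts_of_decides` — a class decided by a bounded program is the UNBOUNDED halting-with-
  `Output = true` class of its underlying BGS program (the polynomial bounds do not enter WHICH class
  is decided, only WHETHER one is), whence `countable_setOf_cptCardDefinable`: only countably many
  classes of finite graphs are CPT+Card-definable (BGS programs are codes).
* `choicelessCapturesP_false_without_PTIME` — dropping `IsPTIMEClass` is fatal: the vertex-count
  classes `{G | G.1 ∈ S}`, `S ⊆ ℕ`, are isomorphism-closed and pairwise distinct, and a diagonal
  `S` escapes every BGS program (Cantor).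
* `choicelessCapturesP_false_without_isoClosed` — dropping `IsIsoClosed` is fatal: the singleton
  class of ONE labelled copy of the one-edge graph on `Fin 3` has a singleton (hence polynomial-time)
  language of codes but is not isomorphism-closed, while every CPT+Card-definable class is
  (`CPTCardDefinable.isIsoClosed`, the tree's invariance theorem).
* `hypotheses_nontrivially_satisfiable` — `noVertexClass` is iso-closed, polynomial-time, and neither
  `∅` nor everything (non-vacuity of the crux's hypotheses beyond the two constant classes).

Refuter seat rattack-stmt-PneNP-18190 (gen 1), 2026-08-17.
-/

set_option linter.dupNamespace false

namespace Summit.PneNP.PneNP.Theorems.ChoicelessCapturesP.Negative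

open Literature.ModelTheory.FiniteModelTheory
open Computability Literature.Computability.Complexity Literature.Computability.Complexity.Classes
  Literature.Computability.MetaComplexity

/-- **Which class a bounded program decides does not depend on its bounds**: if `P` decides `C`,
then `C` is the class of graphs on which the run of the underlying BGS program halts with
`Output = true`. [Blass–Gurevich–Shelah 1999, §5.1] [folklore] -/
theorem eq_setOf_halts_of_decides {P : CPTCardProgram} {C : Set FinGraph} (h : P.Decides C) :
    C = {G | ∃ l, P.prog.HaltsAt G.2 l ∧ (P.prog.stateAt G.2 l).output = HF.ofBool true} := by
  ext G
  constructor
  · intro hG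
    obtain ⟨l, -, hl, -, hout⟩ := (h G).1 hG
    exact ⟨l, hl, hout⟩
  · rintro ⟨l, hl, hout⟩
    by_contra hG
    obtain ⟨l', -, hl', -, hout'⟩ := (h G).2 hG
    obtain rfl : l = l' := hl.unique hl'
    rw [hout] at hout'
    exact absurd (HF.ofBool_injective hout') (by decide)

/-- **Only countably many classes of finite graphs are CPT+Card-definable** (BGS programs are
codes, and by `eq_setOf_halts_of_decides` the decided class is a function of the program alone).
[Blass–Gurevich–Shelah 1999, §5.1 ("use PTime programs as sentences")] [folklore] -/
theorem countable_setOf_cptCardDefinable : {C : Set FinGraph | CPTCardDefinable C}.Countable := by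
  have hsub : {C : Set FinGraph | CPTCardDefinable C} ⊆ Set.range fun Q : BGS.Program =>
      {G : FinGraph | ∃ l, Q.HaltsAt G.2 l ∧ (Q.stateAt G.2 l).output = HF.ofBool true} := by
    rintro C ⟨P, hP⟩
    exact ⟨P.prog, (eq_setOf_halts_of_decides hP).symm⟩
  exact (Set.countable_range _).mono hsub

/-- The vertex-count class `{G | G.1 ∈ S}` of a set `S` of natural numbers is isomorphism-closed.
[folklore] -/
theorem isIsoClosed_vertexCountClass (S : Set ℕ) : IsIsoClosed {G : FinGraph | G.1 ∈ S} := by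
  intro n m G H h
  obtain ⟨e⟩ := h
  obtain rfl : n = m := Fin.equiv_iff_eq.mp ⟨e.toEquiv⟩
  exact Iff.rfl

/-- **`IsPTIMEClass` is load-bearing in `ChoicelessCapturesP`**: it is false that every
isomorphism-closed class of finite graphs is CPT+Card-definable — a Cantor diagonal over the
(countably many) BGS programs produces an isomorphism-closed vertex-count class that no bounded
program decides. Any proof of the crux must use the polynomial-time hypothesis. [folklore] -/
theorem choicelessCapturesP_false_without_PTIME :
    ¬ ∀ C : Set FinGraph, IsIsoClosed C → CPTCardDefinable C := by
  intro h
  haveI : Nonempty BGS.Program := ⟨BGS.constProgram true⟩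
  obtain ⟨e, he⟩ := exists_surjective_nat BGS.Program
  -- the halting-with-`true` class of a program, and the diagonal set of vertex counts
  set F : BGS.Program → Set FinGraph := fun Q =>
    {G : FinGraph | ∃ l, Q.HaltsAt G.2 l ∧ (Q.stateAt G.2 l).output = HF.ofBool true} with hF
  set S : Set ℕ := {n | (⟨n, ⊥⟩ : FinGraph) ∉ F (e n)} with hS
  obtain ⟨P, hP⟩ := h {G : FinGraph | G.1 ∈ S} (isIsoClosed_vertexCountClass S)
  have hCF : {G : FinGraph | G.1 ∈ S} = F P.prog := eq_setOf_halts_of_decides hP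
  obtain ⟨m, hm⟩ := he P.prog
  have key : (⟨m, ⊥⟩ : FinGraph) ∈ {G : FinGraph | G.1 ∈ S} ↔ (⟨m, ⊥⟩ : FinGraph) ∉ F (e m) :=
    Iff.rfl
  rw [hm, ← hCF] at key
  exact iff_not_self key

/-- **`IsIsoClosed` is load-bearing in `ChoicelessCapturesP`**: it is false that every
polynomial-time class of finite graphs is CPT+Card-definable — the singleton class of one
LABELLED copy of the one-edge graph on three vertices has a singleton language of codes (in `P`:
an equaliser of the identity and a constant, `setOf_apply_eq_apply_mem_P`), but it is not
isomorphism-closed, whereas CPT+Card-definable classes are (`CPTCardDefinable.isIsoClosed`).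
Any proof of the crux must use isomorphism-closure. [Blass–Gurevich–Shelah 1999, §1, §4.3]
[folklore] -/
theorem choicelessCapturesP_false_without_isoClosed :
    ¬ ∀ C : Set FinGraph, IsPTIMEClass C → CPTCardDefinable C := by
  intro h
  -- the one-edge graph `0 — 1` on `Fin 3` and its relabelled copy `2 — 1`
  set G₀ : SimpleGraph (Fin 3) := SimpleGraph.edge 0 1 with hG₀
  set C : Set FinGraph := {⟨3, G₀⟩} with hC
  have hlang : graphClassLanguage C = {w | w = encodingGraph.encode (⟨3, G₀⟩ : FinGraph)} := by
    ext w
    constructor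
    · rintro ⟨G, hG, rfl⟩
      rw [Set.mem_singleton_iff.mp hG]
      rfl
    · rintro rfl
      exact ⟨⟨3, G₀⟩, rfl, rfl⟩
  have hP : IsPTIMEClass C := by
    unfold IsPTIMEClass
    rw [hlang]
    exact setOf_apply_eq_apply_mem_P (PolyTimeComputable.id _) (const_mem_FP _)
  have hiso : IsIsoClosed C := (h C hP).isIsoClosed
  let f : Fin 3 ≃ Fin 3 := Equiv.swap 0 2
  have hmem : (⟨3, G₀.map f.toEmbedding⟩ : FinGraph) ∈ C :=
    (hiso G₀ (G₀.map f.toEmbedding) ⟨SimpleGraph.Iso.map f G₀⟩).mp rfl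
  have hEq : G₀.map f.toEmbedding = G₀ :=
    eq_of_heq (Sigma.mk.inj_iff.mp (Set.mem_singleton_iff.mp hmem)).2
  have h01 : G₀.Adj 0 1 := (SimpleGraph.edge_adj _ _ _ _).mpr ⟨Or.inl ⟨rfl, rfl⟩, by decide⟩
  have h21 : (G₀.map f.toEmbedding).Adj 2 1 :=
    (SimpleGraph.map_adj _ _ _ _).mpr ⟨0, 1, h01, by decide, by decide⟩
  have h21' : ¬ G₀.Adj 2 1 := by
    rw [hG₀, SimpleGraph.edge_adj]
    rintro ⟨⟨h2, -⟩ | ⟨-, h1⟩, -⟩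
    · exact absurd h2 (by decide)
    · exact absurd h1 (by decide)
  rw [hEq] at h21
  exact h21' h21

/-- **The hypotheses of the crux are satisfiable by a non-trivial class**: the class of graphs
with no vertices is isomorphism-closed, polynomial-time, non-empty and not everything (so the
crux is not vacuous and does not reduce to the two constant classes decided by
`cptCardDefinable_empty` / `cptCardDefinable_univ`). [folklore] -/
theorem hypotheses_nontrivially_satisfiable :
    ∃ C : Set FinGraph, IsIsoClosed C ∧ IsPTIMEClass C ∧ C.Nonempty ∧ C ≠ Set.univ :=
  ⟨noVertexClass, isIsoClosed_noVertexClass, isPTIMEClass_noVertexClass, ⟨⟨0, ⊥⟩, rfl⟩,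
    fun h => absurd (h ▸ Set.mem_univ (⟨1, ⊥⟩ : FinGraph) : (⟨1, ⊥⟩ : FinGraph) ∈ noVertexClass)
      Nat.one_ne_zero⟩

end Summit.PneNP.PneNP.Theorems.ChoicelessCapturesP.Negative
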